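import Literature.Analysis.FluidPDE.FracTransportHigher
import Literature.Analysis.FluidPDE.OnsagerBDSVEulerApriori
import Literature.Analysis.FluidPDE.OnsagerBDSVPotentialTheoryProofs
import HarnessLib

/-!
# A priori Hölder bounds for smooth solutions of the fractional Navier–Stokes system
# (De Rosa 2019, Prop. 3.5, estimate (3.9))

L. De Rosa, *Infinitely many Leray–Hopf solutions for the fractional Navier–Stokes equations*,
Comm. PDE 44 (2019) 335–365 = arXiv:1801.10235, §3.2, Prop. 3.5: for `ν > 0`, `0 < α < 1` there
is `c = c(α) > 0` such that for smooth data `u₀` and `T ≤ c‖u₀‖_{1+α}⁻¹` the (unique) smooth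
solution of `∂ₜv + (v·∇)v + ∇p + ν(-Δ)^γ v = 0`, `div v = 0`, `v(·,0) = u₀` on `T³ × [0,T]`
"obeys the bounds (3.9) `‖v‖_{N+α} ≲ ‖u₀‖_{N+α}` for all `N ≥ 1`, where the implicit constant
depends on `N` and `α > 0`" (and not on `ν`). The printed proof is the a priori estimate: "Using
Schauder estimate on `-Δp = tr(∇v∇v)` we have `‖p(t)‖_{2+α} ≲ ‖v(t)‖²_{1+α}`, thus,
differentiating the equation in the `x` variable we get
`‖(∂ₜ + v·∇ + ν(-Δ)^γ)Dv‖_α ≲ ‖v(t)‖²_{1+α}`. By Proposition 3.3 …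
`‖v(t)‖_{1+α} ≲ ‖u₀‖_{1+α} + ∫₀ᵗ ‖v(s)‖²_{1+α} ds`. Finally, using Gronwall's inequality …"; and
for `N ≥ 2`: "`‖(∂ₜ + v·∇ + ν(-Δ)^γ)∂^θ v‖_α ≲ ‖v‖_{1+α}‖v‖_{N+α}`, and (3.9) follows by applying
(3.6) and Grönwall's inequality".

This file proves that a priori estimate for **every** smooth solution of the fractional
Navier–Stokes system on a closed time interval `[a,b] × T³` (the tree's
`Torus.IsFracNSReynoldsOn (Icc a b) γ ν v p 0`: jointly smooth `v, p`, the momentum equation with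
the one-sided time derivative, `div v = 0`; `ν ≥ 0`, `0 < γ < 1`), forward in time (data at `a`),
in the dimensionless form of its Euler twin `BDSV.holderCZBound.eulerApriori`
(`OnsagerBDSVEulerApriori.lean`), whose architecture it follows verbatim with De Rosa's
maximum-principle estimates (`FracTransportHolderEstimate.lean`, `FracTransportHigher.lean`) in
place of the transport estimates by characteristics:

* `DeRosa.fracNS_laplacian_pressure_eq` — the pressure equation `Δp = div div R - div((v·∇)v)` of
  a fractional Navier–Stokes–Reynolds triple on a closed interval (the dissipation is FunctionSpaces.Torus.divergence
  free, `Torus.isDivFree_fracLaplacian`);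
* `DeRosa.gradient_pressure_le_fracNS` — `‖∇p‖_{N+1,α} ≤ C ∑ ‖v‖_{m+1,α}‖v‖_{N-m+1,α}`
  (`∂ₘp = -∂ₘΔ⁻¹(∑∂ᵢvⱼ∂ⱼvᵢ)`, no normalisation of the pressure needed; the Calderón–Zygmund bound
  `BDSV.holderCZBound` is proved in the tree, `BDSV.holderCZBound_holds`);
* `DeRosa.bootstrap_Icc_forward` — the forward continuity argument;
* `DeRosa.fracNSApriori` — **the estimate**: for `0 < α < 1` and `N̄` there are `c > 0`, `C ≥ 1`
  with: if `‖v(a)‖_{N,α} ≤ U Λ^{N-1}` (`1 ≤ N ≤ N̄`, `U > 0`, `Λ ≥ 1`) and `(b - a) U ≤ c`, then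
  `‖v(t)‖_{N,α} ≤ C U Λ^{N-1}` on `[a,b]` for `1 ≤ N ≤ N̄`, uniformly in `ν ≥ 0`, `γ ∈ (0,1)`.

## References

* L. De Rosa, Comm. PDE 44 (2019) 335–365 = arXiv:1801.10235, §3.2, Prop. 3.5, (3.9) and its
  proof (p. 7 of the arXiv text); §3.1 Props. 3.2–3.3. [`Derosa2018`]
* T. Buckmaster, C. De Lellis, L. Székelyhidi Jr., V. Vicol, CPAM 72 (2019) = arXiv:1701.08678,
  §3.1, Prop. 3.1 (3.2), Cor. 3.2 (the Euler twin). [`BuckmasterEtAl2018`]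
-/

noncomputable section

open MeasureTheory Set Filter Function
open scoped NNReal ENNReal ContDiff Topology

set_option maxSynthPendingDepth 3

namespace Literature.Analysis.FluidPDE

namespace DeRosa

open FunctionSpaces FunctionSpaces.Torus BDSV

/-! ## The pressure equation and the pressure-FunctionSpaces.Torus.gradient bound -/

section Pressure

variable {d : Type} [Fintype d] [DecidableEq d]

/-- **The pressure equation of a fractional Navier–Stokes–Reynolds triple on a closed time
interval**: for a smooth solution of `∂ₜv + (v·∇)v + ∇p + ν(-Δ)^γ v = div R`, `div v = 0` on
`[a,b] × T^d` (`a < b`, `γ ≥ 0`), at every `t ∈ [a,b]` (endpoints included, one-sided time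
derivative): `Δp(t) = div (div R(t)) - div((v·∇)v)(t)` — the FunctionSpaces.Torus.divergence of `∂ₜv` and of
`(-Δ)^γ v` vanish (De Rosa: "Using Schauder estimate on `-Δp = tr(∇v∇v)`").
[cite: Derosa2018, §3.2 proof of Prop. 3.5] -/
theorem fracNS_laplacian_pressure_eq {a b : ℝ} (hab : a < b) {γ ν : ℝ} (hγ : 0 ≤ γ)
    {v : ℝ → UnitAddTorus d → EuclideanSpace ℝ d} {p : ℝ → UnitAddTorus d → ℝ}
    {R : ℝ → UnitAddTorus d → d → EuclideanSpace ℝ d}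
    (h : Torus.IsFracNSReynoldsOn (Icc a b) γ ν v p R) {t : ℝ} (ht : t ∈ Icc a b)
    (x : UnitAddTorus d) :
    FunctionSpaces.Torus.laplacian (p t) x =
      FunctionSpaces.Torus.divergence (Torus.tensorDivergence (R t)) x - FunctionSpaces.Torus.divergence (FunctionSpaces.Torus.convect (v t) (v t)) x := by
  have hvt : FunctionSpaces.Torus.IsSmooth (v t) := h.smooth_velocity.isSmooth_slice ht
  have hpt : FunctionSpaces.Torus.IsSmooth (p t) := h.smooth_pressure.isSmooth_slice ht
  have hRt : FunctionSpaces.Torus.IsSmooth (R t) := h.smooth_stress.isSmooth_slice ht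
  have hLt : FunctionSpaces.Torus.IsSmooth (Torus.fracLaplacian γ (v t)) := hvt.fracLaplacian hγ
  have hmom : (fun y => Torus.tensorDivergence (R t) y - FunctionSpaces.Torus.convect (v t) (v t) y - FunctionSpaces.Torus.gradient (p t) y -
      ν • Torus.fracLaplacian γ (v t) y) = FunctionSpaces.Torus.timeDerivWithin (Icc a b) v t := by
    funext y
    have hm := h.momentum t ht y
    rw [← hm]
    abel
  have hdiv0 := Torus.divergence_timeDerivWithin_eq_zero hab h.smooth_velocity h.divFree ht x
  rw [← hmom] at hdiv0
  have h1 : FunctionSpaces.Torus.IsContDiff 1 (Torus.tensorDivergence (R t)) := hRt.tensorDivergence.isContDiff (by simp)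
  have h2 : FunctionSpaces.Torus.IsContDiff 1 (FunctionSpaces.Torus.convect (v t) (v t)) := (hvt.convect hvt).isContDiff (by simp)
  have h3 : FunctionSpaces.Torus.IsContDiff 1 (FunctionSpaces.Torus.gradient (p t)) := hpt.gradient.isContDiff (by simp)
  have h4 : FunctionSpaces.Torus.IsContDiff 1 (Torus.fracLaplacian γ (v t)) := hLt.isContDiff (by simp)
  have h4' : FunctionSpaces.Torus.IsContDiff 1 (ν • Torus.fracLaplacian γ (v t)) := h4.smul ν
  have hsub : (fun y => Torus.tensorDivergence (R t) y - FunctionSpaces.Torus.convect (v t) (v t) y - FunctionSpaces.Torus.gradient (p t) y -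
      ν • Torus.fracLaplacian γ (v t) y) =
      ((Torus.tensorDivergence (R t) - FunctionSpaces.Torus.convect (v t) (v t)) - FunctionSpaces.Torus.gradient (p t)) - ν • Torus.fracLaplacian γ (v t) := rfl
  have h12 : FunctionSpaces.Torus.IsContDiff 1 (Torus.tensorDivergence (R t) - FunctionSpaces.Torus.convect (v t) (v t)) := h1.sub h2
  have h123 : FunctionSpaces.Torus.IsContDiff 1 ((Torus.tensorDivergence (R t) - FunctionSpaces.Torus.convect (v t) (v t)) - FunctionSpaces.Torus.gradient (p t)) :=
    h12.sub h3
  have hdivL : FunctionSpaces.Torus.divergence (Torus.fracLaplacian γ (v t)) x = 0 :=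
    Torus.isDivFree_fracLaplacian hγ hvt (h.divFree t ht) x
  rw [hsub, FunctionSpaces.Torus.divergence_sub h123 h4', FunctionSpaces.Torus.divergence_sub h12 h3,
    FunctionSpaces.Torus.divergence_sub h1 h2, Torus.divergence_gradient_eq_laplacian' hpt,
    Torus.divergence_const_smul h4, hdivL, mul_zero, sub_zero] at hdiv0
  linarith

/-- The transport–diffusion form of the momentum equation of an exact solution of the fractional
Navier–Stokes system: `∂ₜv + (v·∇)v + ν(-Δ)^γ v = -∇p` on `[a,b] × T³`.
[cite: Derosa2018, §3.2 (3.8)] -/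
theorem fracNS_transport_eq {a b : ℝ} {γ ν : ℝ}
    {v : ℝ → UnitAddTorus (Fin 3) → EuclideanSpace ℝ (Fin 3)} {p : ℝ → UnitAddTorus (Fin 3) → ℝ}
    (h : Torus.IsFracNSReynoldsOn (Icc a b) γ ν v p (fun _ _ _ => 0)) :
    ∀ s ∈ Icc a b, ∀ x, FunctionSpaces.Torus.timeDerivWithin (Icc a b) v s x + FunctionSpaces.Torus.convect (v s) (v s) x +
      ν • Torus.fracLaplacian γ (v s) x = -FunctionSpaces.Torus.gradient (p s) x := by
  intro s hs x
  have hm := h.momentum s hs x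
  rw [Torus.tensorDivergence_zero] at hm
  have h1 : FunctionSpaces.Torus.timeDerivWithin (Icc a b) v s x + FunctionSpaces.Torus.convect (v s) (v s) x + ν • Torus.fracLaplacian γ (v s) x =
      (FunctionSpaces.Torus.timeDerivWithin (Icc a b) v s x + FunctionSpaces.Torus.convect (v s) (v s) x + FunctionSpaces.Torus.gradient (p s) x +
        ν • Torus.fracLaplacian γ (v s) x) - FunctionSpaces.Torus.gradient (p s) x := by abel
  rw [h1, hm, zero_sub]

omit [Fintype d] in
/-- Partial derivatives ignore additive constants. [folklore] -/
theorem partialDeriv_sub_const {f : UnitAddTorus d → ℝ} (c : ℝ) (m : d) (x : UnitAddTorus d) :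
    FunctionSpaces.Torus.partialDeriv m (fun y => f y - c) x = FunctionSpaces.Torus.partialDeriv m f x := by
  simp only [FunctionSpaces.Torus.partialDeriv, FunctionSpaces.Torus.lineDeriv]
  rw [deriv_sub_const]

/-- **Pressure-FunctionSpaces.Torus.gradient bound for exact solutions of the fractional Navier–Stokes system**
(De Rosa: "Using Schauder estimate on `-Δp = tr(∇v∇v)` we have `‖p(t)‖_{2+α} ≲ ‖v(t)‖²_{1+α}`"
and "`‖∇∂^θp‖_α ≲ ‖tr(∇v∇v)‖_{N-1+α} ≲ ‖v‖_{1+α}‖v‖_{N+α}`"; non-interpolated form, twin of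
`BDSV.holderCZBound.gradient_pressure_le`): for `0 < α < 1` and `N` there is `C` with
`‖∇p(t)‖_{N+1,α} ≤ C ∑_{m ≤ N} ‖v(t)‖_{m+1,α} ‖v(t)‖_{N-m+1,α}` for every smooth solution of the
fractional Navier–Stokes system on `[a,b] × T³` (`γ ≥ 0`) and `t ∈ [a,b]` (`∂ₘp = -∂ₘΔ⁻¹(∑∂ᵢvⱼ∂ⱼvᵢ)`:
no normalisation of the pressure is needed). [cite: Derosa2018, §3.2 proof of Prop. 3.5] -/
theorem gradient_pressure_le_fracNS {α : ℝ≥0} (hα : 0 < α) (hα1 : α < 1) (N : ℕ) :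
    ∃ C : ℝ≥0, ∀ {a b : ℝ}, a < b → ∀ {γ ν : ℝ}, 0 ≤ γ →
      ∀ {v : ℝ → UnitAddTorus (Fin 3) → EuclideanSpace ℝ (Fin 3)} {p : ℝ → UnitAddTorus (Fin 3) → ℝ},
        Torus.IsFracNSReynoldsOn (Icc a b) γ ν v p (fun _ _ _ => 0) → ∀ t ∈ Icc a b,
          Torus.eContDiffHolderNorm (N + 1) α (FunctionSpaces.Torus.gradient (p t)) ≤
            C * ∑ m ∈ Finset.range (N + 1), Torus.eContDiffHolderNorm (m + 1) α (v t) *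
              Torus.eContDiffHolderNorm (N - m + 1) α (v t) := by
  obtain ⟨C, hC⟩ := holderCZBound_holds.partialDeriv_invLaplacian_le hα hα1 N
  refine ⟨3 * C * (9 * 3 ^ N), fun hab γ ν hγ v p h t ht => ?_⟩
  have hvt : FunctionSpaces.Torus.IsSmooth (v t) := h.smooth_velocity.isSmooth_slice ht
  have hpt : FunctionSpaces.Torus.IsSmooth (p t) := h.smooth_pressure.isSmooth_slice ht
  set Q : UnitAddTorus (Fin 3) → ℝ := fun x => ∑ i, ∑ j, FunctionSpaces.Torus.partialDeriv i (v t) x j * FunctionSpaces.Torus.partialDeriv j (v t) x i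
    with hQdef
  have hR0 : Torus.tensorDivergence (fun (_ : UnitAddTorus (Fin 3)) (_ : Fin 3) =>
      (0 : EuclideanSpace ℝ (Fin 3))) = fun _ => 0 := funext fun x => Torus.tensorDivergence_zero x
  have hlap : FunctionSpaces.Torus.laplacian (p t) = -Q := by
    funext x
    rw [fracNS_laplacian_pressure_eq hab hγ h ht x, Pi.neg_apply,
      divergence_convect_self hvt (h.divFree t ht) x, hR0, Torus.divergence_zero, zero_sub]
  have hQ : FunctionSpaces.Torus.IsSmooth Q := by
    have : Q = -FunctionSpaces.Torus.laplacian (p t) := by rw [hlap, neg_neg]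
    rw [this]
    exact hpt.laplacian.neg
  -- the pressure up to its mean: `p(t) - ∫p(t) = -Δ⁻¹Q`
  have hpQ : (fun y => p t y - ∫ z, p t z) = -FunctionSpaces.Torus.invLaplacian Q := by
    funext y
    rw [← invLaplacian_laplacian hpt y, hlap, invLaplacian_neg hQ]
  set S : ℝ≥0∞ := ∑ m ∈ Finset.range (N + 1), Torus.eContDiffHolderNorm (m + 1) α (v t) *
    Torus.eContDiffHolderNorm (N - m + 1) α (v t) with hSdef
  have hQS : Torus.eContDiffHolderNorm N α Q ≤ 9 * 3 ^ N * S := by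
    have h := eContDiffHolderNorm_gradQuad_le hvt N α
    rw [Fintype.card_fin] at h
    refine h.trans (le_of_eq ?_)
    push_cast
    ring
  have hpm : ∀ m, Torus.eContDiffHolderNorm (N + 1) α (FunctionSpaces.Torus.partialDeriv m (p t)) ≤ C * (9 * 3 ^ N * S) := by
    intro m
    have h1 : FunctionSpaces.Torus.partialDeriv m (p t) = -FunctionSpaces.Torus.partialDeriv m (FunctionSpaces.Torus.invLaplacian Q) := by
      funext x
      rw [← partialDeriv_sub_const (∫ z, p t z) m x, hpQ, Pi.neg_apply,
        ← partialDeriv_neg m (FunctionSpaces.Torus.invLaplacian Q) x]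
      rfl
    rw [h1, Torus.eContDiffHolderNorm_neg]
    exact (hC m Q hQ).trans (mul_le_mul' le_rfl hQS)
  calc Torus.eContDiffHolderNorm (N + 1) α (FunctionSpaces.Torus.gradient (p t))
      ≤ ∑ m, Torus.eContDiffHolderNorm (N + 1) α (FunctionSpaces.Torus.partialDeriv m (p t)) :=
        eContDiffHolderNorm_gradient_le_sum hpt (N + 1) α
    _ ≤ ∑ _m : Fin 3, (C : ℝ≥0∞) * (9 * 3 ^ N * S) := Finset.sum_le_sum fun m _ => hpm m
    _ = ((3 * C * (9 * 3 ^ N) : ℝ≥0) : ℝ≥0∞) * S := by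
        simp only [Finset.sum_const, Finset.card_univ, Fintype.card_fin, nsmul_eq_mul]
        push_cast
        ring

end Pressure

/-! ## The forward continuity argument -/

section Bootstrap

/-- **The continuity argument, discretised, forward in time.** Let `μ : ℝ → ℝ≥0∞` on `[a,b]` with
`μ a ≤ B`. If (improvement) on every initial segment `[a,b'] ⊆ [a,b]` the bound `μ ≤ 2B` implies
`μ ≤ B`, and (propagation, uniform step `ε > 0`) `μ s₀ ≤ B` at `s₀ ∈ [a,b]` implies `μ ≤ 2B` on
`[s₀, s₀ + ε] ∩ [a,b]`, then `μ ≤ B` on `[a,b]` (induction on the number of steps of length `ε`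
from `a`; no continuity of `μ` is needed). [folklore] -/
theorem bootstrap_Icc_forward {a b : ℝ} {μ : ℝ → ℝ≥0∞} {B : ℝ≥0∞} {ε : ℝ}
    (hε : 0 < ε) (h0 : μ a ≤ B)
    (himp : ∀ b', b' ≤ b → (∀ s ∈ Icc a b', μ s ≤ 2 * B) → ∀ s ∈ Icc a b', μ s ≤ B)
    (hprop : ∀ s₀ ∈ Icc a b, μ s₀ ≤ B → ∀ s ∈ Icc a b, s₀ ≤ s → s - s₀ ≤ ε → μ s ≤ 2 * B) :
    ∀ t ∈ Icc a b, μ t ≤ B := by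
  -- `P n`: the bound holds within distance `n ε` of `a`
  have hP : ∀ n : ℕ, ∀ s ∈ Icc a b, s - a ≤ n * ε → μ s ≤ B := by
    intro n
    induction n with
    | zero =>
      intro s hs hst
      have : s = a := by
        have h : s - a ≤ 0 := by simpa using hst
        linarith [hs.1]
      rw [this]
      exact h0
    | succ n IH =>
      intro s hs hst
      set b' := min b (a + (n + 1) * ε) with hb'
      have hb'b : b' ≤ b := min_le_left _ _
      have hnε : 0 ≤ (n + 1 : ℝ) * ε := by positivity
      -- `μ ≤ 2B` on `[a, b']`
      have h2B : ∀ x ∈ Icc a b', μ x ≤ 2 * B := by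
        intro x hx
        have hxJ : x ∈ Icc a b := ⟨hx.1, hx.2.trans hb'b⟩
        by_cases hxn : x - a ≤ n * ε
        · exact (IH x hxJ hxn).trans (by
            calc B = 1 * B := (one_mul B).symm
              _ ≤ 2 * B := mul_le_mul' (by norm_num) le_rfl)
        · rw [not_le] at hxn
          have hn0 : 0 ≤ (n : ℝ) * ε := by positivity
          set s₀ := a + n * ε with hs₀
          have hs₀x : s₀ ≤ x := by linarith
          have hs₀J : s₀ ∈ Icc a b := ⟨by linarith, hs₀x.trans hxJ.2⟩
          have hμ₀ : μ s₀ ≤ B := IH s₀ hs₀J (by rw [hs₀]; linarith)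
          refine hprop s₀ hs₀J hμ₀ x hxJ hs₀x ?_
          have h1 : x ≤ a + (n + 1) * ε := hx.2.trans (min_le_right _ _)
          rw [hs₀]
          linarith
      -- improvement
      have hsI : s ∈ Icc a b' := by
        push_cast at hst
        exact ⟨hs.1, le_min hs.2 (by linarith)⟩
      exact himp b' hb'b h2B s hsI
  intro t ht
  obtain ⟨n, hn⟩ := exists_nat_ge ((t - a) / ε)
  exact hP n t ht (by rwa [div_le_iff₀ hε] at hn)

end Bootstrap

/-! ## The level-`1` bound: the continuity argument -/

section LevelOne

/-- **One step of the level-`1` a priori estimate** (fractional twin of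
`BDSV.holderCZBound.levelOne_step`). For `0 < α < 1` there is `P` such that: for a smooth exact
solution of the fractional Navier–Stokes system on `[a,b] × T³` (`ν ≥ 0`, `0 < γ < 1`) with
`‖v(s)‖_{1,α} ≤ W` on `[a,b]` and `W (b - a) ≤ 1/4`, and `s₀ ∈ [a,b]` with `μ(s₀) ≤ m₀`,
`μ(s) := ‖v(s)‖_∞ + ∑ₖ ‖∂ₖv(s)‖_{0,α}`, one has `μ(s) ≤ (3/2) m₀ + (b - a) P W²` for
`s ∈ [s₀, b]` (the maximum-principle `C⁰` and `C^{0,α}` estimates of De Rosa's §3.1 for `v` and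
the `∂ₖv`, forward in time; the forcing `-∇p`, `-∂ₖ∇p - (∂ₖv·∇)v` being `≲ W²` by the pressure
bound: "Using Schauder estimate on `-Δp = tr(∇v∇v)` … By Proposition 3.3 …", De Rosa §3.2).
[cite: Derosa2018, §3.2 Prop. 3.5 (proof)] -/
theorem fracNS_levelOne_step {α : ℝ≥0} (hα : 0 < α) (hα1 : α < 1) :
    ∃ P : ℝ, 0 ≤ P ∧ ∀ {a b : ℝ} (_ : a < b)
      {γ ν : ℝ} (_ : 0 ≤ ν) (_ : 0 < γ) (_ : γ < 1)
      {v : ℝ → UnitAddTorus (Fin 3) → EuclideanSpace ℝ (Fin 3)} {p : ℝ → UnitAddTorus (Fin 3) → ℝ}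
      (_ : Torus.IsFracNSReynoldsOn (Icc a b) γ ν v p (fun _ _ _ => 0)) {W : ℝ} (_ : 0 ≤ W)
      (_ : ∀ s ∈ Icc a b, Torus.eContDiffHolderNorm 1 α (v s) ≤ ENNReal.ofReal W)
      (_ : W * (b - a) ≤ 1 / 4) {s₀ : ℝ} (_ : s₀ ∈ Icc a b) {m₀ : ℝ} (_ : 0 ≤ m₀)
      (_ : eSupNorm (v s₀) + ∑ k, Torus.eContDiffHolderNorm 0 α (FunctionSpaces.Torus.partialDeriv k (v s₀)) ≤
        ENNReal.ofReal m₀),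
      ∀ s ∈ Icc a b, s₀ ≤ s → eSupNorm (v s) + ∑ k, Torus.eContDiffHolderNorm 0 α (FunctionSpaces.Torus.partialDeriv k (v s)) ≤
        ENNReal.ofReal (3 / 2 * m₀ + (b - a) * P * W ^ 2) := by
  obtain ⟨C₀, hC₀⟩ := gradient_pressure_le_fracNS hα hα1 0
  refine ⟨C₀ + 9 * (C₀ + 1), by positivity, ?_⟩
  intro a b hab γ ν hν hγ0 hγ1 v p h W hW hvW hWL s₀ hs₀ m₀ hm₀ hμ₀ s hs hs₀s
  have hL : 0 < b - a := sub_pos.2 hab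
  set L := b - a with hLdef
  have hU : UniqueDiffOn ℝ (Icc a b) := uniqueDiffOn_Icc hab
  have hvs : ∀ s ∈ Icc a b, FunctionSpaces.Torus.IsSmooth (v s) := fun s hs => h.smooth_velocity.isSmooth_slice hs
  have hps : ∀ s ∈ Icc a b, FunctionSpaces.Torus.IsSmooth (p s) := fun s hs => h.smooth_pressure.isSmooth_slice hs
  -- the forcing `G = -∇p` and its bound
  set G : ℝ → UnitAddTorus (Fin 3) → EuclideanSpace ℝ (Fin 3) := fun s x => -FunctionSpaces.Torus.gradient (p s) x with hGdef
  have hG : FunctionSpaces.Torus.IsSmoothSpaceTimeOn (Icc a b) G := (h.smooth_pressure.gradient hU).neg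
  have heq := fracNS_transport_eq h
  have hGb : ∀ s ∈ Icc a b, Torus.eContDiffHolderNorm 1 α (G s) ≤ ENNReal.ofReal (C₀ * W ^ 2) := by
    intro s hs
    have hGs : G s = -FunctionSpaces.Torus.gradient (p s) := rfl
    rw [hGs, Torus.eContDiffHolderNorm_neg]
    refine (hC₀ hab hγ0.le h s hs).trans ?_
    rw [Finset.sum_range_one, Nat.sub_zero, zero_add, ENNReal.ofReal_mul (NNReal.coe_nonneg C₀),
      ENNReal.ofReal_coe_nnreal, sq, ENNReal.ofReal_mul hW]
    exact mul_le_mul' le_rfl (mul_le_mul' (hvW s hs) (hvW s hs))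
  -- velocity FunctionSpaces.Torus.gradient bound
  have hK : ∀ s ∈ Icc a b, ∀ x, ‖Torus.fderiv (v s) x‖ ≤ (⟨W, hW⟩ : ℝ≥0) := fun s hs x =>
    norm_fderiv_le_of_eContDiffHolderNorm_one_le hW (hvW s hs) x
  -- the datum pieces are finite
  have hμT : eSupNorm (v s₀) + ∑ k, Torus.eContDiffHolderNorm 0 α (FunctionSpaces.Torus.partialDeriv k (v s₀)) ≠ ⊤ :=
    ne_top_of_le_ne_top ENNReal.ofReal_ne_top hμ₀
  have hE₀T : eSupNorm (v s₀) ≠ ⊤ := ne_top_of_le_ne_top hμT le_self_add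
  have hAT : ∀ k, Torus.eContDiffHolderNorm 0 α (FunctionSpaces.Torus.partialDeriv k (v s₀)) ≠ ⊤ := fun k =>
    ne_top_of_le_ne_top hμT ((Finset.single_le_sum (f := fun k =>
      Torus.eContDiffHolderNorm 0 α (FunctionSpaces.Torus.partialDeriv k (v s₀))) (fun _ _ => bot_le)
      (Finset.mem_univ k)).trans le_add_self)
  set E₀ : ℝ := (eSupNorm (v s₀)).toReal with hE₀
  set A : Fin 3 → ℝ := fun k => (Torus.eContDiffHolderNorm 0 α (FunctionSpaces.Torus.partialDeriv k (v s₀))).toReal with hA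
  have hE₀0 : 0 ≤ E₀ := ENNReal.toReal_nonneg
  have hA0 : ∀ k, 0 ≤ A k := fun k => ENNReal.toReal_nonneg
  have hsum : E₀ + ∑ k, A k ≤ m₀ := by
    have h1 : (eSupNorm (v s₀) + ∑ k, Torus.eContDiffHolderNorm 0 α (FunctionSpaces.Torus.partialDeriv k (v s₀))).toReal ≤ m₀ :=
      ENNReal.toReal_le_of_le_ofReal hm₀ hμ₀
    rwa [ENNReal.toReal_add hE₀T (ENNReal.sum_ne_top.2 fun k _ => hAT k),
      ENNReal.toReal_sum fun k _ => hAT k] at h1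
  -- (i) the sup norm of `v`
  have hst : s - s₀ ≤ L := by linarith [hs.2, hs₀.1]
  have hst0 : 0 ≤ s - s₀ := sub_nonneg.2 hs₀s
  have hsubI : Icc s₀ s ⊆ Icc a b := fun s' hs' => ⟨hs₀.1.trans hs'.1, hs'.2.trans hs.2⟩
  have h1 : eSupNorm (v s) ≤ ENNReal.ofReal (E₀ + L * (C₀ * W ^ 2)) := by
    have h := Torus.eSupNorm_fracTransport_le h.smooth_velocity hν hγ0 hγ1 heq hs₀ hs hs₀s
    refine h.trans ?_
    have hsupG : (⨆ s' ∈ Icc s₀ s, eSupNorm (G s')) ≤ ENNReal.ofReal (C₀ * W ^ 2) :=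
      iSup₂_le fun s' hs' => (Torus.eSupNorm_le_eContDiffHolderNorm 1 α _).trans
        (hGb s' (hsubI hs'))
    calc eSupNorm (v s₀) + ENNReal.ofReal (s - s₀) * ⨆ s' ∈ Icc s₀ s, eSupNorm (G s')
        ≤ ENNReal.ofReal E₀ + ENNReal.ofReal L * ENNReal.ofReal (C₀ * W ^ 2) := by
          refine add_le_add (le_of_eq (ENNReal.ofReal_toReal hE₀T).symm) ?_
          exact mul_le_mul' (ENNReal.ofReal_le_ofReal hst) hsupG
      _ = ENNReal.ofReal (E₀ + L * (C₀ * W ^ 2)) := by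
          rw [← ENNReal.ofReal_mul hL.le, ← ENNReal.ofReal_add hE₀0 (by positivity)]
  -- (ii) the `C^{0,α}` norms of the `∂ₖv`
  have h2 : ∀ k, Torus.eContDiffHolderNorm 0 α (FunctionSpaces.Torus.partialDeriv k (v s)) ≤
      ENNReal.ofReal (3 / 2 * (A k + 2 * L * ((C₀ + 1) * W ^ 2))) := by
    intro k
    set Fk : ℝ → UnitAddTorus (Fin 3) → EuclideanSpace ℝ (Fin 3) := fun t => FunctionSpaces.Torus.partialDeriv k (v t) with hFk
    set Gk : ℝ → UnitAddTorus (Fin 3) → EuclideanSpace ℝ (Fin 3) := fun t x =>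
      FunctionSpaces.Torus.partialDeriv k (G t) x - FunctionSpaces.Torus.convect (FunctionSpaces.Torus.partialDeriv k (v t)) (v t) x with hGk
    have hFk' : FunctionSpaces.Torus.IsSmoothSpaceTimeOn (Icc a b) Fk := h.smooth_velocity.partialDeriv hU k
    have heqk : ∀ s ∈ Icc a b, ∀ x,
        FunctionSpaces.Torus.timeDerivWithin (Icc a b) Fk s x + FunctionSpaces.Torus.convect (v s) (Fk s) x + ν • Torus.fracLaplacian γ (Fk s) x = Gk s x :=
      fun s hs x => Torus.fracTransport_partialDeriv hab hγ0.le h.smooth_velocity h.smooth_velocity heq k hs x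
    -- forcing bound
    have hGk' : ∀ s' ∈ Icc s₀ s, Torus.eContDiffHolderNorm 0 α (Gk s') ≤
        ENNReal.ofReal ((C₀ + 1) * W ^ 2) := by
      intro s' hs'
      have hs'J : s' ∈ Icc a b := hsubI hs'
      have hvs' := hvs s' hs'J
      have hGs' : FunctionSpaces.Torus.IsSmooth (G s') := hG.isSmooth_slice hs'J
      have hp1 : Torus.eContDiffHolderNorm 0 α (FunctionSpaces.Torus.partialDeriv k (G s')) ≤ ENNReal.ofReal (C₀ * W ^ 2) :=
        (Torus.eContDiffHolderNorm_partialDeriv_le (isContDiff_nat_of_isSmooth hGs' 1) k α).trans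
          (hGb s' hs'J)
      have hp2 : Torus.eContDiffHolderNorm 0 α (FunctionSpaces.Torus.convect (FunctionSpaces.Torus.partialDeriv k (v s')) (v s')) ≤
          ENNReal.ofReal (W ^ 2) := by
        have hc := Torus.eContDiffHolderNorm_convect_le (u := FunctionSpaces.Torus.partialDeriv k (v s')) (v := v s')
          (isContDiff_nat_of_isSmooth (hvs'.partialDeriv k) 0) (isContDiff_nat_of_isSmooth hvs' 1) α (k := 0)
        refine hc.trans ?_
        rw [pow_zero, one_mul, Finset.sum_range_one, Nat.sub_zero, zero_add, sq, ENNReal.ofReal_mul hW]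
        exact mul_le_mul' ((Torus.eContDiffHolderNorm_partialDeriv_le
          (isContDiff_nat_of_isSmooth hvs' 1) k α).trans (hvW s' hs'J)) (hvW s' hs'J)
      have hsub : FunctionSpaces.Torus.IsContDiff 0 (FunctionSpaces.Torus.partialDeriv k (G s')) := isContDiff_nat_of_isSmooth (hGs'.partialDeriv k) 0
      have hconv : FunctionSpaces.Torus.IsContDiff 0 (FunctionSpaces.Torus.convect (FunctionSpaces.Torus.partialDeriv k (v s')) (v s')) :=
        isContDiff_nat_of_isSmooth ((hvs'.partialDeriv k).convect hvs') 0
      have hGk_eq : Gk s' = FunctionSpaces.Torus.partialDeriv k (G s') - FunctionSpaces.Torus.convect (FunctionSpaces.Torus.partialDeriv k (v s')) (v s') := rfl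
      rw [hGk_eq]
      refine (Torus.eContDiffHolderNorm_sub_le hsub hconv).trans ?_
      rw [add_mul, one_mul, ENNReal.ofReal_add (by positivity) (by positivity)]
      exact add_le_add hp1 hp2
    have hAk : Torus.eContDiffHolderNorm 0 α (Fk s₀) ≤ ENNReal.ofReal (A k) :=
      le_of_eq (ENNReal.ofReal_toReal (hAT k)).symm
    have h := Torus.eContDiffHolderNorm_fracTransport_le hab h.smooth_velocity hFk' hν hγ0 hγ1 heqk hK hs₀ hs
      hs₀s hα1 (hA0 k) (by positivity) hAk hGk'
    refine h.trans (ENNReal.ofReal_le_ofReal ?_)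
    have hexp : Real.exp (α * (⟨W, hW⟩ : ℝ≥0) * (s - s₀)) ≤ 3 / 2 := by
      have hα0 : (0 : ℝ) ≤ α := α.2
      have hαle : (α : ℝ) ≤ 1 := by exact_mod_cast hα1.le
      refine BDSV.exp_le_three_halves (by positivity) ?_
      calc (α : ℝ) * (⟨W, hW⟩ : ℝ≥0) * (s - s₀) = α * (W * (s - s₀)) := by simp [mul_assoc]
        _ ≤ 1 * (W * L) :=
            mul_le_mul hαle (mul_le_mul_of_nonneg_left hst hW) (by positivity) zero_le_one
        _ ≤ 1 / 4 := by linarith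
    have hin : 0 ≤ A k + 2 * (s - s₀) * ((C₀ + 1) * W ^ 2) := by positivity
    have hmono : A k + 2 * (s - s₀) * ((C₀ + 1) * W ^ 2) ≤ A k + 2 * L * ((C₀ + 1) * W ^ 2) := by
      have h7 : (s - s₀) * ((C₀ + 1) * W ^ 2) ≤ L * ((C₀ + 1) * W ^ 2) :=
        mul_le_mul_of_nonneg_right hst (by positivity)
      linarith only [h7]
    exact mul_le_mul hexp hmono hin (by norm_num)
  -- assemble
  calc eSupNorm (v s) + ∑ k, Torus.eContDiffHolderNorm 0 α (FunctionSpaces.Torus.partialDeriv k (v s))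
      ≤ ENNReal.ofReal (E₀ + L * (C₀ * W ^ 2)) +
          ∑ k, ENNReal.ofReal (3 / 2 * (A k + 2 * L * ((C₀ + 1) * W ^ 2))) :=
        add_le_add h1 (Finset.sum_le_sum fun k _ => h2 k)
    _ = ENNReal.ofReal (E₀ + L * (C₀ * W ^ 2) + ∑ k, 3 / 2 * (A k + 2 * L * ((C₀ + 1) * W ^ 2))) := by
        rw [ENNReal.ofReal_add (by positivity) (Finset.sum_nonneg fun k _ => by
          have := hA0 k; positivity), ENNReal.ofReal_sum_of_nonneg fun k _ => by have := hA0 k; positivity]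
    _ ≤ ENNReal.ofReal (3 / 2 * m₀ + L * (C₀ + 9 * (C₀ + 1)) * W ^ 2) := by
        refine ENNReal.ofReal_le_ofReal ?_
        have hS : ∑ k : Fin 3, 3 / 2 * (A k + 2 * L * ((C₀ + 1) * W ^ 2)) =
            3 / 2 * (∑ k, A k) + 9 * L * ((C₀ + 1) * W ^ 2) := by
          rw [← Finset.mul_sum, Finset.sum_add_distrib, Finset.sum_const, Finset.card_univ,
            Fintype.card_fin]
          simp only [nsmul_eq_mul, Nat.cast_ofNat]
          ring
        rw [hS]
        have hS0 : 0 ≤ ∑ k, A k := Finset.sum_nonneg fun k _ => hA0 k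
        nlinarith [hsum, hE₀0, hS0]

/-- **The level-`1` a priori bound** (De Rosa Prop. 3.5, (3.9) for `N = 1`, for every smooth
exact solution of the fractional Navier–Stokes system; twin of `BDSV.holderCZBound.eulerApriori_one`):
for `0 < α < 1` there is `c > 0` such that, if `‖v(a)‖_{1,α} ≤ U` and `(b - a) U ≤ c`, then
`‖v(t)‖_{1,α} ≤ 8U` on `[a,b]` (forward continuity argument `DeRosa.bootstrap_Icc_forward` on
`μ = ‖v‖_∞ + ∑ₖ‖∂ₖv‖_{0,α}`, with `DeRosa.fracNS_levelOne_step`). [cite: Derosa2018, §3.2 Prop. 3.5 (3.9)] -/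
theorem fracNSApriori_one {α : ℝ≥0} (hα : 0 < α) (hα1 : α < 1) :
    ∃ c : ℝ, 0 < c ∧ ∀ {a b : ℝ} (_ : a < b)
      {γ ν : ℝ} (_ : 0 ≤ ν) (_ : 0 < γ) (_ : γ < 1)
      {v : ℝ → UnitAddTorus (Fin 3) → EuclideanSpace ℝ (Fin 3)} {p : ℝ → UnitAddTorus (Fin 3) → ℝ}
      (_ : Torus.IsFracNSReynoldsOn (Icc a b) γ ν v p (fun _ _ _ => 0)) {U : ℝ} (_ : 0 < U)
      (_ : Torus.eContDiffHolderNorm 1 α (v a) ≤ ENNReal.ofReal U) (_ : (b - a) * U ≤ c),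
      ∀ t ∈ Icc a b, Torus.eContDiffHolderNorm 1 α (v t) ≤ ENNReal.ofReal (8 * U) := by
  obtain ⟨P, hP0, hstep⟩ := fracNS_levelOne_step hα hα1
  refine ⟨min (1 / 64) (1 / (128 * P + 1)), lt_min (by norm_num) (by positivity), ?_⟩
  intro a b hab γ ν hν hγ0 hγ1 v p h U hU hvU hc
  have ht₀ : a ∈ Icc a b := left_mem_Icc.2 hab.le
  have hc1 : (b - a) * U ≤ 1 / 64 := hc.trans (min_le_left _ _)
  have hc2 : (b - a) * U ≤ 1 / (128 * P + 1) := hc.trans (min_le_right _ _)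
  have hvs : ∀ s ∈ Icc a b, FunctionSpaces.Torus.IsSmooth (v s) := fun s hs => h.smooth_velocity.isSmooth_slice hs
  -- the bootstrap quantity
  set μ : ℝ → ℝ≥0∞ := fun s => eSupNorm (v s) + ∑ k, Torus.eContDiffHolderNorm 0 α (FunctionSpaces.Torus.partialDeriv k (v s))
    with hμdef
  have hF1 : ∀ s ∈ Icc a b, Torus.eContDiffHolderNorm 1 α (v s) ≤ μ s := fun s hs =>
    BDSV.eContDiffHolderNorm_succ_le_sum (hvs s hs) 0 α
  have hF2 : ∀ s ∈ Icc a b, μ s ≤ 4 * Torus.eContDiffHolderNorm 1 α (v s) := by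
    intro s hs
    have h1 : eSupNorm (v s) ≤ Torus.eContDiffHolderNorm 1 α (v s) := Torus.eSupNorm_le_eContDiffHolderNorm 1 α _
    have h2 : ∀ k, Torus.eContDiffHolderNorm 0 α (FunctionSpaces.Torus.partialDeriv k (v s)) ≤ Torus.eContDiffHolderNorm 1 α (v s) :=
      fun k => Torus.eContDiffHolderNorm_partialDeriv_le (BDSV.isContDiff_nat_of_isSmooth (hvs s hs) 1) k α
    calc μ s ≤ Torus.eContDiffHolderNorm 1 α (v s) + ∑ _k : Fin 3, Torus.eContDiffHolderNorm 1 α (v s) :=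
          add_le_add h1 (Finset.sum_le_sum fun k _ => h2 k)
      _ = 4 * Torus.eContDiffHolderNorm 1 α (v s) := by
          simp only [Finset.sum_const, Finset.card_univ, Fintype.card_fin, nsmul_eq_mul]
          push_cast
          ring
  set B : ℝ≥0∞ := ENNReal.ofReal (8 * U) with hB
  have hμ₀ : μ a ≤ ENNReal.ofReal (4 * U) := by
    refine (hF2 a ht₀).trans ?_
    rw [ENNReal.ofReal_mul (by norm_num), ENNReal.ofReal_ofNat]
    exact mul_le_mul' le_rfl hvU
  have h0 : μ a ≤ B := hμ₀.trans (ENNReal.ofReal_le_ofReal (by linarith))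
  have h2B : 2 * B = ENNReal.ofReal (16 * U) := by
    rw [hB, ← ENNReal.ofReal_ofNat 2, ← ENNReal.ofReal_mul (by norm_num)]
    congr 1
    ring
  -- finiteness of the `C^{1,α}` norms (for the propagation step)
  obtain ⟨Mf, hMf0, hMf⟩ := BDSV.exists_forall_eContDiffHolderNorm_le_of_Icc hab 1 hα1.le h.smooth_velocity
  set M' : ℝ := Mf + 1 with hM'
  have hM'0 : 0 < M' := by linarith
  have hvM' : ∀ s ∈ Icc a b, Torus.eContDiffHolderNorm 1 α (v s) ≤ ENNReal.ofReal M' := fun s hs =>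
    (hMf s hs).trans (ENNReal.ofReal_le_ofReal (by linarith))
  set ε : ℝ := min (1 / (8 * M')) (2 * U / (P * M' ^ 2 + 1)) with hεdef
  have hε : 0 < ε := lt_min (by positivity) (by positivity)
  have hε1 : ε ≤ 1 / (8 * M') := min_le_left _ _
  have hε2 : ε ≤ 2 * U / (P * M' ^ 2 + 1) := min_le_right _ _
  -- restriction of the solution to subintervals
  have hres : ∀ {a' b' : ℝ}, a' < b' → Icc a' b' ⊆ Icc a b →
      Torus.IsFracNSReynoldsOn (Icc a' b') γ ν v p (fun _ _ _ => 0) :=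
    fun hab' hsub => h.mono hsub (uniqueDiffOn_Icc hab')
  -- improvement
  have himp : ∀ b', b' ≤ b → (∀ s ∈ Icc a b', μ s ≤ 2 * B) → ∀ s ∈ Icc a b', μ s ≤ B := by
    intro b' hb' h2 s hs
    set a' := a with ha'def
    rcases eq_or_lt_of_le (hs.1.trans hs.2) with heq | hab'
    · have : s = a := by
        have h1 : s ∈ Icc a b' := hs
        rw [← heq, Icc_self, mem_singleton_iff] at h1
        exact h1
      rw [this]
      exact h0
    have hsub : Icc a b' ⊆ Icc a b := Icc_subset_Icc le_rfl hb'
    have ht₀' : a ∈ Icc a b' := left_mem_Icc.2 hab'.le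
    have hW : ∀ s ∈ Icc a b', Torus.eContDiffHolderNorm 1 α (v s) ≤ ENNReal.ofReal (16 * U) :=
      fun s hs => (hF1 s (hsub hs)).trans (h2B ▸ h2 s hs)
    have hWL : 16 * U * (b' - a) ≤ 1 / 4 := by nlinarith
    have h := hstep hab' hν hγ0 hγ1 (hres hab' hsub) (by positivity : (0 : ℝ) ≤ 16 * U) hW hWL ht₀'
      (by positivity : (0 : ℝ) ≤ 4 * U) hμ₀ s hs hs.1
    refine h.trans (ENNReal.ofReal_le_ofReal ?_)
    have hPc : 256 * P * ((b - a) * U) ≤ 2 := by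
      calc 256 * P * ((b - a) * U) ≤ 256 * P * (1 / (128 * P + 1)) :=
            mul_le_mul_of_nonneg_left hc2 (by positivity)
        _ ≤ 2 := by
            rw [mul_one_div, div_le_iff₀ (by positivity)]
            nlinarith
    have hk : (b' - a) * P * (16 * U) ^ 2 ≤ 2 * U := by
      have hba : (b' - a) * U ≤ (b - a) * U := mul_le_mul_of_nonneg_right (by linarith) hU.le
      calc (b' - a) * P * (16 * U) ^ 2 = U * (256 * P * ((b' - a) * U)) := by ring
        _ ≤ U * (256 * P * ((b - a) * U)) :=
            mul_le_mul_of_nonneg_left (mul_le_mul_of_nonneg_left hba (by positivity)) hU.le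
        _ ≤ U * 2 := mul_le_mul_of_nonneg_left hPc hU.le
        _ = 2 * U := by ring
    linarith
  -- propagation
  have hprop : ∀ s₀ ∈ Icc a b, μ s₀ ≤ B → ∀ s ∈ Icc a b, s₀ ≤ s → s - s₀ ≤ ε → μ s ≤ 2 * B := by
    intro s₀ hs₀ hμs₀ s hs hs₀s hss₀
    set a' := s₀ with ha'
    set b' := min b (s₀ + ε) with hb'
    have hsub : Icc a' b' ⊆ Icc a b := fun x hx =>
      ⟨hs₀.1.trans hx.1, hx.2.trans (min_le_left _ _)⟩
    have hs₀' : s₀ ∈ Icc a' b' := ⟨le_rfl, le_min hs₀.2 (by linarith)⟩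
    have hs' : s ∈ Icc a' b' := ⟨hs₀s, le_min hs.2 (by linarith)⟩
    rcases eq_or_lt_of_le (hs₀'.1.trans hs₀'.2) with heq | hab'
    · have : s = s₀ := by
        rw [← heq, Icc_self, mem_singleton_iff] at hs' hs₀'
        rw [hs', hs₀']
      rw [this]
      exact hμs₀.trans (by
        calc B = 1 * B := (one_mul B).symm
          _ ≤ 2 * B := mul_le_mul' (by norm_num) le_rfl)
    have hlen : b' - a' ≤ 2 * ε := by
      have h1 : b' ≤ s₀ + ε := min_le_right _ _
      rw [ha']
      linarith
    have hWL : M' * (b' - a') ≤ 1 / 4 := by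
      calc M' * (b' - a') ≤ M' * (2 * ε) := mul_le_mul_of_nonneg_left hlen hM'0.le
        _ ≤ M' * (2 * (1 / (8 * M'))) := by gcongr
        _ = 1 / 4 := by field_simp; ring
    have h := hstep hab' hν hγ0 hγ1 (hres hab' hsub) hM'0.le (fun s hs => hvM' s (hsub hs)) hWL hs₀'
      (by positivity : (0 : ℝ) ≤ 8 * U) hμs₀ s hs' hs₀s
    rw [h2B]
    refine h.trans (ENNReal.ofReal_le_ofReal ?_)
    have hεP : (b' - a') * P * M' ^ 2 ≤ 4 * U := by
      calc (b' - a') * P * M' ^ 2 ≤ (2 * ε) * P * M' ^ 2 := by gcongr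
        _ = 2 * (ε * (P * M' ^ 2)) := by ring
        _ ≤ 2 * (2 * U / (P * M' ^ 2 + 1) * (P * M' ^ 2)) := by gcongr
        _ ≤ 2 * (2 * U) := by
            refine mul_le_mul_of_nonneg_left ?_ (by norm_num)
            rw [div_mul_eq_mul_div, div_le_iff₀ (by positivity)]
            nlinarith
        _ = 4 * U := by ring
    linarith
  -- conclude
  have hall := bootstrap_Icc_forward hε h0 himp hprop
  intro t ht
  exact (hF1 t ht).trans (hall t ht)

end LevelOne

/-! ## All levels: induction with the level-`N` transport–diffusion estimate -/

section AllLevels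

/-- The induction step of `DeRosa.fracNSApriori`: bounds for the levels `≤ N̄` (`N̄ ≥ 1`) give
bounds for the levels `≤ N̄ + 1` (the level-`N̄+1` transport–diffusion estimate for
`∂ₜv + (v·∇)v + ν(-Δ)^γ v = -∇p`, the pressure bound, and absorption of the top-order norm).
[cite: Derosa2018, §3.2 Prop. 3.5 (3.9)] -/
theorem fracNSApriori_succ {α : ℝ≥0} (hα : 0 < α) (hα1 : α < 1)
    {Nbar : ℕ} (hNbar : 0 < Nbar) {c C : ℝ} (hc0 : 0 < c) (hC1 : 1 ≤ C)
    (hIH : ∀ {a b : ℝ} (_ : a < b)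
      {γ ν : ℝ} (_ : 0 ≤ ν) (_ : 0 < γ) (_ : γ < 1)
      {v : ℝ → UnitAddTorus (Fin 3) → EuclideanSpace ℝ (Fin 3)} {p : ℝ → UnitAddTorus (Fin 3) → ℝ}
      (_ : Torus.IsFracNSReynoldsOn (Icc a b) γ ν v p (fun _ _ _ => 0)) {U Λ : ℝ} (_ : 0 < U) (_ : 1 ≤ Λ)
      (_ : ∀ N, 1 ≤ N → N ≤ Nbar →
        Torus.eContDiffHolderNorm N α (v a) ≤ ENNReal.ofReal (U * Λ ^ (N - 1)))
      (_ : (b - a) * U ≤ c),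
      ∀ t ∈ Icc a b, ∀ N, 1 ≤ N → N ≤ Nbar →
        Torus.eContDiffHolderNorm N α (v t) ≤ ENNReal.ofReal (C * U * Λ ^ (N - 1))) :
    ∃ c' : ℝ, 0 < c' ∧ ∃ C' : ℝ, 1 ≤ C' ∧ ∀ {a b : ℝ} (_ : a < b)
      {γ ν : ℝ} (_ : 0 ≤ ν) (_ : 0 < γ) (_ : γ < 1)
      {v : ℝ → UnitAddTorus (Fin 3) → EuclideanSpace ℝ (Fin 3)} {p : ℝ → UnitAddTorus (Fin 3) → ℝ}
      (_ : Torus.IsFracNSReynoldsOn (Icc a b) γ ν v p (fun _ _ _ => 0)) {U Λ : ℝ} (_ : 0 < U) (_ : 1 ≤ Λ)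
      (_ : ∀ N, 1 ≤ N → N ≤ Nbar + 1 →
        Torus.eContDiffHolderNorm N α (v a) ≤ ENNReal.ofReal (U * Λ ^ (N - 1)))
      (_ : (b - a) * U ≤ c'),
      ∀ t ∈ Icc a b, ∀ N, 1 ≤ N → N ≤ Nbar + 1 →
        Torus.eContDiffHolderNorm N α (v t) ≤ ENNReal.ofReal (C' * U * Λ ^ (N - 1)) := by
  -- the level `N = Nbar + 1 ≥ 2`
  set N := Nbar + 1 with hNdef
  obtain ⟨A, hA1, hTN⟩ := Torus.eContDiffHolderNorm_fracTransport_higher (d := Fin 3) N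
  obtain ⟨CP, hCP⟩ := gradient_pressure_le_fracNS hα hα1 (N - 1)
  have hC0 : 0 < C := by linarith
  have hA0 : 0 < A := by linarith
  obtain ⟨Q, hQdef⟩ : ∃ Q : ℝ, Q = (CP : ℝ) * N + N := ⟨_, rfl⟩
  have hQ0 : 0 ≤ Q := by rw [hQdef]; positivity
  have hQ1 : 0 < 2 * A * C * Q + 1 := by
    have := mul_nonneg (mul_nonneg (mul_nonneg (by norm_num : (0 : ℝ) ≤ 2) hA0.le) hC0.le) hQ0
    linarith
  have hQ2 : 0 < C ^ 2 * Q + 1 := by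
    have := mul_nonneg (sq_nonneg C) hQ0
    linarith
  obtain ⟨c', hc'def⟩ : ∃ c' : ℝ, c' = min c (min (1 / (2 * C)) (min (1 / (C * A))
    (min (1 / (2 * A * C * Q + 1)) (1 / (C ^ 2 * Q + 1))))) := ⟨_, rfl⟩
  have hc'0 : 0 < c' := by
    rw [hc'def]
    exact lt_min hc0 (lt_min (by positivity) (lt_min (by positivity)
      (lt_min (one_div_pos.2 hQ1) (one_div_pos.2 hQ2))))
  have hc'c : c' ≤ c := by rw [hc'def]; exact min_le_left _ _
  have hc'1 : c' ≤ 1 / (2 * C) := by rw [hc'def]; exact (min_le_right _ _).trans (min_le_left _ _)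
  have hc'2 : c' ≤ 1 / (C * A) := by
    rw [hc'def]; exact (min_le_right _ _).trans ((min_le_right _ _).trans (min_le_left _ _))
  have hc'3 : c' ≤ 1 / (2 * A * C * Q + 1) := by
    rw [hc'def]
    exact (min_le_right _ _).trans ((min_le_right _ _).trans ((min_le_right _ _).trans (min_le_left _ _)))
  have hc'4 : c' ≤ 1 / (C ^ 2 * Q + 1) := by
    rw [hc'def]
    exact (min_le_right _ _).trans ((min_le_right _ _).trans ((min_le_right _ _).trans (min_le_right _ _)))
  refine ⟨c', hc'0, max C (4 * A), le_max_of_le_left hC1, ?_⟩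
  intro a b hab γ ν hν hγ0 hγ1 v p h U Λ hU hΛ hdat hc t ht
  have ht₀ : a ∈ Icc a b := left_mem_Icc.2 hab.le
  have hL : 0 < b - a := sub_pos.2 hab
  set L := b - a with hLdef
  have hLU : L * U ≤ c' := hc
  have hU0 : 0 ≤ U := hU.le
  have hΛ0 : 0 ≤ Λ := zero_le_one.trans hΛ
  have hvs : ∀ s ∈ Icc a b, FunctionSpaces.Torus.IsSmooth (v s) := fun s hs => h.smooth_velocity.isSmooth_slice hs
  -- levels `≤ Nbar` from the induction hypothesis
  have hlow : ∀ s ∈ Icc a b, ∀ j, 1 ≤ j → j ≤ Nbar →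
      Torus.eContDiffHolderNorm j α (v s) ≤ ENNReal.ofReal (C * U * Λ ^ (j - 1)) :=
    fun s hs j hj hjN => hIH hab hν hγ0 hγ1 h hU hΛ (fun N' h1 h2 => hdat N' h1 (h2.trans (Nat.le_succ _)))
      (hLU.trans hc'c) s hs j hj hjN
  have hone : ∀ s ∈ Icc a b, Torus.eContDiffHolderNorm 1 α (v s) ≤ ENNReal.ofReal (C * U) := by
    intro s hs
    have h := hlow s hs 1 le_rfl hNbar
    rwa [Nat.sub_self, pow_zero, mul_one] at h
  -- the top level: finiteness and the supremum `M`
  obtain ⟨Bfin, hBfin0, hBfin⟩ := BDSV.exists_forall_eContDiffHolderNorm_le_of_Icc hab N hα1.le h.smooth_velocity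
  set S := ⨆ s ∈ Icc a b, Torus.eContDiffHolderNorm N α (v s) with hSdef
  have hSle : S ≤ ENNReal.ofReal Bfin := iSup₂_le fun s hs => hBfin s hs
  have hST : S ≠ ⊤ := ne_top_of_le_ne_top ENNReal.ofReal_ne_top hSle
  obtain ⟨M, hMdef⟩ : ∃ M : ℝ, M = S.toReal := ⟨_, rfl⟩
  have hM0 : 0 ≤ M := by rw [hMdef]; exact ENNReal.toReal_nonneg
  have hMS : ENNReal.ofReal M = S := by rw [hMdef, ENNReal.ofReal_toReal hST]
  have hvM : ∀ s ∈ Icc a b, Torus.eContDiffHolderNorm N α (v s) ≤ ENNReal.ofReal M := by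
    intro s hs
    rw [hMS]
    exact le_iSup₂ (f := fun s _ => Torus.eContDiffHolderNorm N α (v s)) s hs
  -- data for the level-`N` transport estimate
  have hCU : 0 ≤ C * U := by positivity
  have hK : ∀ s ∈ Icc a b, ∀ x, ‖Torus.fderiv (v s) x‖ ≤ (⟨C * U, hCU⟩ : ℝ≥0) :=
    fun s hs x => BDSV.norm_fderiv_le_of_eContDiffHolderNorm_one_le hCU (hone s hs) x
  have hKL : ((⟨C * U, hCU⟩ : ℝ≥0) : ℝ) * (b - a) ≤ 1 / 2 := by
    change C * U * L ≤ 1 / 2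
    calc C * U * L = C * (L * U) := by ring
      _ ≤ C * (1 / (2 * C)) := mul_le_mul_of_nonneg_left (hLU.trans hc'1) hC0.le
      _ = 1 / 2 := by field_simp
  set V : ℕ → ℝ := fun j => if j ≤ Nbar then C * U * Λ ^ (j - 1) else M with hVdef
  have hV0 : ∀ j, 0 ≤ V j := fun j => by
    simp only [hVdef]
    split_ifs
    · positivity
    · exact hM0
  have hV1 : V 1 = C * U := by
    have h1 : (1 : ℕ) ≤ Nbar := hNbar
    simp only [hVdef, h1, if_true, Nat.sub_self, pow_zero, mul_one]
  have hV : ∀ s ∈ Icc a b, ∀ j, 1 ≤ j → j ≤ N →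
      Torus.eContDiffHolderNorm j α (v s) ≤ ENNReal.ofReal (V j) := by
    intro s hs j hj hjN
    by_cases hjb : j ≤ Nbar
    · simp only [hVdef, hjb, if_true]
      exact hlow s hs j hj hjb
    · have hjeq : j = N := by omega
      simp only [hVdef, hjb, if_false]
      rw [hjeq]
      exact hvM s hs
  have hsmall : (b - a) * V 1 * A ≤ 1 := by
    rw [hV1]
    calc L * (C * U) * A = (C * A) * (L * U) := by ring
      _ ≤ (C * A) * (1 / (C * A)) := mul_le_mul_of_nonneg_left (hLU.trans hc'2) (by positivity)
      _ = 1 := by field_simp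
  set G : ℝ → UnitAddTorus (Fin 3) → EuclideanSpace ℝ (Fin 3) := fun s x => -FunctionSpaces.Torus.gradient (p s) x with hGdef
  have hG : FunctionSpaces.Torus.IsSmoothSpaceTimeOn (Icc a b) G := (h.smooth_pressure.gradient (uniqueDiffOn_Icc hab)).neg
  have heq := fracNS_transport_eq h
  set Φ : ℕ → ℝ := fun m => C * U * Λ ^ (m - 1) with hΦdef
  have hΦ0 : ∀ m, 0 ≤ Φ m := fun m => by positivity
  have hΦ : ∀ s ∈ Icc a b, ∀ m, 1 ≤ m → m < N →
      Torus.eContDiffHolderNorm m α (v s) ≤ ENNReal.ofReal (Φ m) :=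
    fun s hs m hm hmN => hlow s hs m hm (Nat.lt_succ_iff.1 hmN)
  have hF₀ : Torus.eContDiffHolderNorm N α (v a) ≤ ENNReal.ofReal (U * Λ ^ (N - 1)) :=
    hdat N (Nat.le_add_left 1 Nbar) le_rfl
  -- the uniform bound for products of two norms of complementary orders
  obtain ⟨T, hTdef⟩ : ∃ T : ℝ, T = C * U * M + C ^ 2 * U ^ 2 * Λ ^ (N - 1) := ⟨_, rfl⟩
  have hT0 : 0 ≤ T := by rw [hTdef]; positivity
  have hT1 : C * U * M ≤ T := by rw [hTdef]; exact le_add_of_nonneg_right (by positivity)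
  have hT2 : C ^ 2 * U ^ 2 * Λ ^ (N - 1) ≤ T := by rw [hTdef]; exact le_add_of_nonneg_left (by positivity)
  have hpair : ∀ s ∈ Icc a b, ∀ i j, 1 ≤ i → 1 ≤ j → i + j = N + 1 →
      Torus.eContDiffHolderNorm i α (v s) * Torus.eContDiffHolderNorm j α (v s) ≤ ENNReal.ofReal T := by
    intro s hs i j hi hj hij
    by_cases hib : i ≤ Nbar
    · by_cases hjb : j ≤ Nbar
      · -- both below the top level
        calc _ ≤ ENNReal.ofReal (C * U * Λ ^ (i - 1)) * ENNReal.ofReal (C * U * Λ ^ (j - 1)) :=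
              mul_le_mul' (hlow s hs i hi hib) (hlow s hs j hj hjb)
          _ = ENNReal.ofReal (C ^ 2 * U ^ 2 * Λ ^ (N - 1)) := by
              rw [← ENNReal.ofReal_mul (by positivity)]
              congr 1
              have hpow : Λ ^ (i - 1) * Λ ^ (j - 1) = Λ ^ (N - 1) := by
                rw [← pow_add]; congr 1; omega
              calc C * U * Λ ^ (i - 1) * (C * U * Λ ^ (j - 1))
                  = C ^ 2 * U ^ 2 * (Λ ^ (i - 1) * Λ ^ (j - 1)) := by ring
                _ = _ := by rw [hpow]
          _ ≤ ENNReal.ofReal T := ENNReal.ofReal_le_ofReal hT2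
      · -- `j` is the top level, `i = 1`
        have hjeq : j = N := by omega
        have hieq : i = 1 := by omega
        subst hjeq; subst hieq
        calc _ ≤ ENNReal.ofReal (C * U) * ENNReal.ofReal M := mul_le_mul' (hone s hs) (hvM s hs)
          _ = ENNReal.ofReal (C * U * M) := by rw [← ENNReal.ofReal_mul hCU]
          _ ≤ ENNReal.ofReal T := ENNReal.ofReal_le_ofReal hT1
    · have hieq : i = N := by omega
      have hjeq : j = 1 := by omega
      subst hieq; subst hjeq
      calc _ ≤ ENNReal.ofReal M * ENNReal.ofReal (C * U) := mul_le_mul' (hvM s hs) (hone s hs)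
        _ = ENNReal.ofReal (C * U * M) := by rw [← ENNReal.ofReal_mul hM0]; congr 1; ring
        _ ≤ ENNReal.ofReal T := ENNReal.ofReal_le_ofReal hT1
  -- the forcing bound
  have hCPN : (0 : ℝ) ≤ CP * N := by positivity
  have hGb : ∀ s ∈ Icc a b, Torus.eContDiffHolderNorm N α (G s) ≤ ENNReal.ofReal (CP * N * T) := by
    intro s hs
    have hGs : G s = -FunctionSpaces.Torus.gradient (p s) := rfl
    rw [hGs, Torus.eContDiffHolderNorm_neg]
    have h := hCP hab hγ0.le h s hs
    rw [show N - 1 + 1 = N from Nat.succ_pred_eq_of_pos (Nat.succ_pos _)] at h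
    refine h.trans ?_
    calc (CP : ℝ≥0∞) * ∑ m ∈ Finset.range N, Torus.eContDiffHolderNorm (m + 1) α (v s) *
          Torus.eContDiffHolderNorm (N - 1 - m + 1) α (v s)
        ≤ (CP : ℝ≥0∞) * ∑ _m ∈ Finset.range N, ENNReal.ofReal T := by
          refine mul_le_mul' le_rfl (Finset.sum_le_sum fun m hm => ?_)
          have hmN : m < N := Finset.mem_range.1 hm
          exact hpair s hs (m + 1) (N - 1 - m + 1) (Nat.le_add_left 1 m) (Nat.le_add_left 1 _) (by omega)
      _ = ENNReal.ofReal (CP * N * T) := by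
          rw [Finset.sum_const, Finset.card_range, nsmul_eq_mul, ENNReal.ofReal_mul hCPN,
            ENNReal.ofReal_mul (NNReal.coe_nonneg CP), ENNReal.ofReal_coe_nnreal, ENNReal.ofReal_natCast]
          ring
  -- apply the level-`N` transport estimate
  have hTN' := hTN hab hα1 hν hγ0 hγ1 h.smooth_velocity hK hKL hV0 hV hsmall h.smooth_velocity hG heq hΦ0 hΦ
    (by positivity : (0 : ℝ) ≤ U * Λ ^ (N - 1)) (mul_nonneg hCPN hT0) hF₀ hGb
  -- the lower-order sum
  have hlowsum : ∑ i ∈ Finset.range (N - 1), V (i + 2) * Φ (N - 1 - i) ≤ (N - 1 : ℕ) * T := by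
    calc ∑ i ∈ Finset.range (N - 1), V (i + 2) * Φ (N - 1 - i) ≤ ∑ _i ∈ Finset.range (N - 1), T := by
          refine Finset.sum_le_sum fun i hi => ?_
          have hiN : i < N - 1 := Finset.mem_range.1 hi
          simp only [hVdef, hΦdef]
          split_ifs with hib
          · have hpow : Λ ^ (i + 2 - 1) * Λ ^ (N - 1 - i - 1) = Λ ^ (N - 1) := by
              rw [← pow_add]; congr 1; omega
            calc C * U * Λ ^ (i + 2 - 1) * (C * U * Λ ^ (N - 1 - i - 1))
                = C ^ 2 * U ^ 2 * (Λ ^ (i + 2 - 1) * Λ ^ (N - 1 - i - 1)) := by ring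
              _ = C ^ 2 * U ^ 2 * Λ ^ (N - 1) := by rw [hpow]
              _ ≤ T := hT2
          · have hi2 : N - 1 - i - 1 = 0 := by omega
            rw [hi2, pow_zero, mul_one]
            calc M * (C * U) = C * U * M := by ring
              _ ≤ T := hT1
      _ = (N - 1 : ℕ) * T := by rw [Finset.sum_const, Finset.card_range, nsmul_eq_mul]
  -- the bound `X` for the top norms and absorption
  have hN1 : (0 : ℝ) ≤ ((N - 1 : ℕ) : ℝ) := Nat.cast_nonneg _
  obtain ⟨X, hXdef⟩ : ∃ X : ℝ, X = A * (U * Λ ^ (N - 1) + L * (CP * N * T) + L * ((N - 1 : ℕ) * T)) :=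
    ⟨_, rfl⟩
  have hX0 : 0 ≤ X := by
    rw [hXdef]
    exact mul_nonneg hA0.le (add_nonneg (add_nonneg (by positivity) (mul_nonneg hL.le
      (mul_nonneg hCPN hT0))) (mul_nonneg hL.le (mul_nonneg hN1 hT0)))
  have hvX : ∀ s ∈ Icc a b, Torus.eContDiffHolderNorm N α (v s) ≤ ENNReal.ofReal X := fun s hs => by
    rw [hXdef]
    exact (hTN' s hs).trans (ENNReal.ofReal_le_ofReal (mul_le_mul_of_nonneg_left
      (add_le_add le_rfl (mul_le_mul_of_nonneg_left hlowsum hL.le)) hA0.le))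
  have hMX : M ≤ X := by
    have h1 : S ≤ ENNReal.ofReal X := iSup₂_le fun s hs => hvX s hs
    rw [← hMS] at h1
    exact (ENNReal.ofReal_le_ofReal_iff hX0).1 h1
  -- `X = X' + θ M` with `θ ≤ 1/2`
  have hNQ : (CP : ℝ) * N + ((N - 1 : ℕ) : ℝ) ≤ Q := by
    rw [hQdef]
    have : ((N - 1 : ℕ) : ℝ) ≤ N := by exact_mod_cast Nat.sub_le N 1
    linarith
  have hR0 : (0 : ℝ) ≤ CP * N + ((N - 1 : ℕ) : ℝ) := add_nonneg hCPN hN1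
  have hθ : A * L * (CP * N + (N - 1 : ℕ)) * (C * U) ≤ 1 / 2 := by
    have h1 : A * C * (CP * N + (N - 1 : ℕ)) ≤ A * C * Q := mul_le_mul_of_nonneg_left hNQ (by positivity)
    have h2 : (A * C * Q) * (1 / (2 * A * C * Q + 1)) ≤ 1 / 2 := by
      rw [mul_one_div, div_le_iff₀ hQ1]
      linarith
    calc A * L * (CP * N + (N - 1 : ℕ)) * (C * U) = (A * C * (CP * N + (N - 1 : ℕ))) * (L * U) := by ring
      _ ≤ (A * C * Q) * c' := mul_le_mul h1 hLU (mul_nonneg hL.le hU0)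
          (mul_nonneg (mul_nonneg hA0.le hC0.le) hQ0)
      _ ≤ (A * C * Q) * (1 / (2 * A * C * Q + 1)) :=
          mul_le_mul_of_nonneg_left hc'3 (mul_nonneg (mul_nonneg hA0.le hC0.le) hQ0)
      _ ≤ 1 / 2 := h2
  have hlow2 : L * (CP * N + (N - 1 : ℕ)) * (C ^ 2 * U ^ 2) ≤ U := by
    have h1 : C ^ 2 * (CP * N + (N - 1 : ℕ)) ≤ C ^ 2 * Q := mul_le_mul_of_nonneg_left hNQ (sq_nonneg C)
    have h2 : (C ^ 2 * Q) * (1 / (C ^ 2 * Q + 1)) ≤ 1 := by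
      rw [mul_one_div, div_le_iff₀ hQ2]
      linarith
    calc L * (CP * N + (N - 1 : ℕ)) * (C ^ 2 * U ^ 2)
        = (C ^ 2 * (CP * N + (N - 1 : ℕ))) * (L * U) * U := by ring
      _ ≤ (C ^ 2 * Q) * c' * U :=
          mul_le_mul_of_nonneg_right (mul_le_mul h1 hLU (mul_nonneg hL.le hU0)
            (mul_nonneg (sq_nonneg C) hQ0)) hU0
      _ ≤ (C ^ 2 * Q) * (1 / (C ^ 2 * Q + 1)) * U :=
          mul_le_mul_of_nonneg_right (mul_le_mul_of_nonneg_left hc'4 (mul_nonneg (sq_nonneg C) hQ0)) hU0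
      _ ≤ 1 * U := mul_le_mul_of_nonneg_right h2 hU0
      _ = U := one_mul U
  have hXsplit : X = A * (U * Λ ^ (N - 1) + L * (CP * N + (N - 1 : ℕ)) * (C ^ 2 * U ^ 2) * Λ ^ (N - 1)) +
      (A * L * (CP * N + (N - 1 : ℕ)) * (C * U)) * M := by
    rw [hXdef, hTdef]
    ring
  have hM2 : M ≤ 4 * A * U * Λ ^ (N - 1) := by
    have hΛN : 0 ≤ Λ ^ (N - 1) := by positivity
    have h3 : L * (CP * N + (N - 1 : ℕ)) * (C ^ 2 * U ^ 2) * Λ ^ (N - 1) ≤ U * Λ ^ (N - 1) :=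
      mul_le_mul_of_nonneg_right hlow2 hΛN
    have h4 : (A * L * (CP * N + (N - 1 : ℕ)) * (C * U)) * M ≤ (1 / 2) * M :=
      mul_le_mul_of_nonneg_right hθ hM0
    have h5 : A * (U * Λ ^ (N - 1) + L * (CP * N + (N - 1 : ℕ)) * (C ^ 2 * U ^ 2) * Λ ^ (N - 1)) ≤
        2 * A * U * Λ ^ (N - 1) := by
      have h6 := mul_le_mul_of_nonneg_left (add_le_add (le_refl (U * Λ ^ (N - 1))) h3) hA0.le
      calc _ ≤ A * (U * Λ ^ (N - 1) + U * Λ ^ (N - 1)) := h6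
        _ = 2 * A * U * Λ ^ (N - 1) := by ring
    have h1 : M ≤ 2 * A * U * Λ ^ (N - 1) + (1 / 2) * M :=
      calc M ≤ X := hMX
        _ = _ := hXsplit
        _ ≤ 2 * A * U * Λ ^ (N - 1) + (1 / 2) * M := add_le_add h5 h4
    linarith
  -- conclude
  intro N' hN'1 hN'N
  by_cases hb : N' ≤ Nbar
  · refine (hlow t ht N' hN'1 hb).trans (ENNReal.ofReal_le_ofReal ?_)
    exact mul_le_mul_of_nonneg_right (mul_le_mul_of_nonneg_right (le_max_left _ _) hU0) (by positivity)
  · have hN'eq : N' = N := by omega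
    rw [hN'eq]
    refine (hvM t ht).trans (ENNReal.ofReal_le_ofReal (hM2.trans ?_))
    have hmax : 4 * A ≤ max C (4 * A) := le_max_right _ _
    exact mul_le_mul_of_nonneg_right (mul_le_mul_of_nonneg_right hmax hU0) (by positivity)

/-- **A priori Hölder bounds for exact solutions of the fractional Navier–Stokes system, all
orders** (De Rosa 2019, Prop. 3.5, (3.9): "`v` obeys the bounds `‖v‖_{N+α} ≲ ‖u₀‖_{N+α}` for all
`N ≥ 1`", for `T ≤ c‖u₀‖_{1+α}⁻¹`, with implicit constants independent of `ν`; here for every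
smooth exact solution on a closed time interval, forward in time, in the dimensionless form of the
twin `BDSV.holderCZBound.eulerApriori`, and unconditionally — the Calderón–Zygmund input
`BDSV.holderCZBound` is proved in the tree): for `0 < α < 1` and `N̄` there are `c > 0` and `C ≥ 1`
such that for every `ν ≥ 0`, `0 < γ < 1`, every smooth solution `(v, p)` of
`∂ₜv + (v·∇)v + ∇p + ν(-Δ)^γ v = 0`, `div v = 0` on `[a,b] × T³` (`Torus.IsFracNSReynoldsOn` with
zero stress), `U > 0`, `Λ ≥ 1` with `‖v(a)‖_{N,α} ≤ U Λ^{N-1}` for `1 ≤ N ≤ N̄` and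
`(b - a) U ≤ c`: `‖v(t)‖_{N,α} ≤ C U Λ^{N-1}` for all `t ∈ [a,b]` and `1 ≤ N ≤ N̄`.
[cite: Derosa2018, §3.2 Prop. 3.5 (3.9)] -/
theorem fracNSApriori {α : ℝ≥0} (hα : 0 < α) (hα1 : α < 1)
    (Nbar : ℕ) :
    ∃ c : ℝ, 0 < c ∧ ∃ C : ℝ, 1 ≤ C ∧ ∀ {a b : ℝ} (_ : a < b)
      {γ ν : ℝ} (_ : 0 ≤ ν) (_ : 0 < γ) (_ : γ < 1)
      {v : ℝ → UnitAddTorus (Fin 3) → EuclideanSpace ℝ (Fin 3)} {p : ℝ → UnitAddTorus (Fin 3) → ℝ}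
      (_ : Torus.IsFracNSReynoldsOn (Icc a b) γ ν v p (fun _ _ _ => 0)) {U Λ : ℝ} (_ : 0 < U) (_ : 1 ≤ Λ)
      (_ : ∀ N, 1 ≤ N → N ≤ Nbar →
        Torus.eContDiffHolderNorm N α (v a) ≤ ENNReal.ofReal (U * Λ ^ (N - 1)))
      (_ : (b - a) * U ≤ c),
      ∀ t ∈ Icc a b, ∀ N, 1 ≤ N → N ≤ Nbar →
        Torus.eContDiffHolderNorm N α (v t) ≤ ENNReal.ofReal (C * U * Λ ^ (N - 1)) := by
  induction Nbar with
  | zero =>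
    refine ⟨1, one_pos, 1, le_rfl, ?_⟩
    intro a b _ γ ν _ _ _ v p _ U Λ _ _ _ _ t _ N h1 h2
    omega
  | succ Nbar IH =>
    obtain ⟨c, hc0, C, hC1, hIH⟩ := IH
    rcases Nat.eq_zero_or_pos Nbar with hNbar | hNbar
    · -- only the level `1`
      subst hNbar
      obtain ⟨c₁, hc₁, hone⟩ := fracNSApriori_one hα hα1
      refine ⟨c₁, hc₁, 8, by norm_num, ?_⟩
      intro a b hab γ ν hν hγ0 hγ1 v p h U Λ hU hΛ hdat hc t ht N h1 h2
      have hN : N = 1 := by omega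
      subst hN
      have hd := hdat 1 le_rfl le_rfl
      rw [Nat.sub_self, pow_zero, mul_one] at hd
      have h := hone hab hν hγ0 hγ1 h hU hd hc t ht
      rwa [Nat.sub_self, pow_zero, mul_one]
    exact fracNSApriori_succ hα hα1 hNbar hc0 hC1 hIH

end AllLevels

end DeRosa

end Literature.Analysis.FluidPDE
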